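import Summits.SmoothPoincare4.SmoothPoincare4.Theorems.CylinderEntropyCylinderRungTwoKillingFluxDefs
import Literature.Geometry.Riemannian.ColdingMinicozziEntropy
import HarnessLib

/-!
# Route `CylinderEntropy`, crux `CylinderRungTwo` (stmt-SmoothPoincare4-7631), line `killing-flux`:
# the White debt of path A in Literature form (lead c2)

The open registered stub `stub_whiteRegularitySheet` of the skeleton (White's local regularity theorem, Ann. of Math. 161
(2005) Thm. 3.1 + §4, single-sheet form, for `IsCylinderMCF` flows) is, with the line's flow structure `IsCylinderMCF` unfolded
into its eight fields, a statement in pure Literature vocabulary — proposed as the named fact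
`Literature.Geometry.Riemannian.White2005_localRegularity_cylinderFlowSheet`
(`Literature/Geometry/Riemannian/WhiteLocalRegularityCylinderFlow.lean`).  This file proves the (trivial) glue, registered as
`helper_whiteSheetOfFact`: the inlined Literature statement implies the stub's statement (destructure `IsCylinderMCF`).
No `sorry`, no definitions, no facts asserted.
-/

noncomputable section

set_option linter.dupNamespace false

open MeasureTheory Set Filter
open scoped Manifold ContDiff ENNReal NNReal Topology BigOperators

namespace Summit.SmoothPoincare4.SmoothPoincare4.Cruxes.CylinderRungTwo.KillingFlux

open Literature.Geometry.Riemannian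
open Literature.Geometry.Lorentzian Literature.Geometry.Lorentzian.PseudoRiemannianMetric

/-- **Registered helper `helper_whiteSheetOfFact`**: White's local regularity theorem for cylinder flows in its Literature
(structure-free) form implies the skeleton's registered stub `stub_whiteRegularitySheet` — unfold `IsCylinderMCF` into its
fields `contMDiffOn`, `isSmoothEmbedding`, `mem_cyl`, `isSpacelikeImmersion`, `isUnitNormal`, `normal_tangent`,
`contMDiff_normal`, `velocity_eq`. [cite: White2005, Thm. 3.1 and §4] -/
theorem helper_whiteSheetOfFact : (∃ ε : ℝ, 0 < ε ∧ ∃ C : ℝ, 0 < C ∧ ∃ c : ℝ, 0 < c ∧ ∃ c₁ : ℝ, 0 < c₁ ∧ ∃ d₀ : ℝ, 0 < d₀ ∧ ∀ (M : Type) [TopologicalSpace M] [T2Space M] [SecondCountableTopology M] [ChartedSpace (EuclideanSpace ℝ (Fin 4)) M] [IsManifold (𝓡 4) ∞ M] [CompactSpace M] [ConnectedSpace M] (F : ℝ → M → EuclideanSpace ℝ (Fin 6)) (ν : ℝ → M → EuclideanSpace ℝ (Fin 6)) (T : ℝ), (∃ U : Set ℝ, IsOpen U ∧ Set.Ici T ⊆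 U ∧ ContMDiffOn (𝓘(ℝ, ℝ).prod (𝓡 4)) (𝓡 6) ∞ (fun p : ℝ × M => F p.1 p.2) (U ×ˢ Set.univ)) → (∀ t, T ≤ t → Manifold.IsSmoothEmbedding (𝓡 4) (𝓡 6) ∞ (F t)) → (∀ t, T ≤ t → ∀ x, ∑ i : Fin 5, F t x (Fin.castSucc i) ^ 2 = 1) → ∀ himm : ∀ t, T ≤ t → (euclideanMetric (EuclideanSpace ℝ (Fin 6))).IsSpacelikeImmersion (𝓡 4) (F t), (∀ t, T ≤ t → (euclideanMetric (EuclideanSpace ℝ (Fin 6))).IsUnitNormal (𝓡 4) (F t) (ν t) 1) → (∀ t, T ≤ t → ∀ x, ∑ i : Fin 5, ν t x (Fin.castSucc i) * F t x (Fin.castSucc i) = 0) → (∀ t, T ≤ t → ContMDiff (𝓡 4) (𝓡 6) ∞ (ν t)) → (∀ t (ht : T ≤ t) (x : M), mfderiv 𝓘(ℝ, ℝ) (𝓡 6) (fun s => F s x) t (1 : ℝ) = -((euclideanMetric (EuclideanSpace ℝ (Fin 6))).meanCurvature (F t) contMDiff_pullbackBilin_holds (himm t ht) (ν t) x) • ν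 t x) → ∀ t d : ℝ, 0 < d → d ≤ d₀ → T + d ^ 2 ≤ t → (∀ (y : EuclideanSpace ℝ (Fin 6)) (s r : ℝ), 0 < r → t - d ^ 2 ≤ s - r ^ 2 → s ≤ t + d ^ 2 → gaussianArea 4 y (r ^ 2) (Set.range (F (s - r ^ 2))) ≤ ENNReal.ofReal (1 + ε)) → (∀ x y : M, ‖F t x - F t y‖ ≤ c₁ * d → ‖ν t x - ν t y‖ ≤ C / d * ‖F t x - F t y‖) ∧ (∀ x : M, ∀ r : ℝ, 0 < r → r ≤ c₁ * d → ENNReal.ofReal (c * r ^ 4) ≤ μH[4] (Set.range (F t) ∩ Metric.ball (F t x) r))) → ∃ ε : ℝ, 0 < ε ∧ ∃ C : ℝ, 0 < C ∧ ∃ c : ℝ, 0 < c ∧ ∃ c₁ : ℝ, 0 < c₁ ∧ ∃ d₀ : ℝ, 0 < d₀ ∧ ∀ (M : Type) [TopologicalSpace M] [T2Space M] [SecondCountableTopology M] [ChartedSpace (EuclideanSpace ℝ (Fin 4)) M] [IsManifold (𝓡 4) ∞ M] [CompactSpace M] [ConnectedSpace M] (F : ℝ → M → EuclideanSpace ℝ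 (Fin 6)) (ν : ℝ → M → EuclideanSpace ℝ (Fin 6)) (T : ℝ), IsCylinderMCF M F ν T → ∀ t d : ℝ, 0 < d → d ≤ d₀ → T + d ^ 2 ≤ t → (∀ (y : EuclideanSpace ℝ (Fin 6)) (s r : ℝ), 0 < r → t - d ^ 2 ≤ s - r ^ 2 → s ≤ t + d ^ 2 → gaussianArea 4 y (r ^ 2) (Set.range (F (s - r ^ 2))) ≤ ENNReal.ofReal (1 + ε)) → (∀ x y : M, ‖F t x - F t y‖ ≤ c₁ * d → ‖ν t x - ν t y‖ ≤ C / d * ‖F t x - F t y‖) ∧ (∀ x : M, ∀ r : ℝ, 0 < r → r ≤ c₁ * d → ENNReal.ofReal (c * r ^ 4) ≤ μH[4] (Set.range (F t) ∩ Metric.ball (F t x) r)) := by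
  rintro ⟨ε, hε, C, hC, c, hc, c₁, hc₁, d₀, hd₀, hW⟩
  refine ⟨ε, hε, C, hC, c, hc, c₁, hc₁, d₀, hd₀, ?_⟩
  intro M _ _ _ _ _ _ _ F ν T hF
  exact hW M F ν T hF.contMDiffOn hF.isSmoothEmbedding hF.mem_cyl hF.isSpacelikeImmersion hF.isUnitNormal
    hF.normal_tangent hF.contMDiff_normal hF.velocity_eq

end Summit.SmoothPoincare4.SmoothPoincare4.Cruxes.CylinderRungTwo.KillingFlux

end
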